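import Literature.NumberTheory.LFunctions.MoebiusWalshTypeIICore
import Literature.NumberTheory.LFunctions.MoebiusWalshTypeIEstimate
import HarnessLib

/-!
# Type-II core count (`K = 0`) specialised to Walsh characters (Bourgain 2013, §2 (2.5), (2.11)–(2.22))

Topic `Literature/NumberTheory/LFunctions`; proofs-only (theorems, no definition, no named fact).
This short file plugs the Fourier data of a Walsh character into the abstract type-II core count
`MoebiusWalshTypeII.typeII_core_zero` (Bourgain 2013 [Bourgain2013MoebiusWalsh], §2,
(2.11)–(2.22) with `K = 0`):

* `abs_sum_Ico_natWalsh_mul_natWalsh_le` — the Fourier expansion step (2.5)/(2.11) for the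
  differenced Walsh product read on `ℕ` (`MoebiusWalshVaughan.natWalsh`, the weight of `boxSum`),
  with the geometric-series majorant in place of the paper's smooth cutoff: for a digit set
  `T ⊆ [0, q)`, `A = T.attachFin _`, and every `n, h` and interval `[a, b)` of the short variable,
  `|∑_{a ≤ m < b} w_T(m(n+h)) w_T(mn)| ≤ ∑_{k,k'<2^q} |ŵ_A(k/2^q)| |ŵ_A(k'/2^q)| min(b-a, 1/(2‖(k(n+h)+k'n)/2^q‖))`;
* `typeII_core_zero_walsh` — `typeII_core_zero` with `c(k) = |ŵ_A(k/2^q)|`,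
  `η = 2·2^{-c₂|A|}` (Lemma 2, `c₂ = walshSupExponent`, tree's `norm_walshCoeff_le_two_mul_rpow`) and
  `P(m) = 2·2^{κ(q-m)}` (Lemma 4, `κ = walshL1Exponent`, tree's `bourgain2013_lemma4`).

Combined with the tree's van der Corput step (`MoebiusWalsh.vdC_bilinear`) and digit truncation
(`MoebiusWalshTypeII.natWalsh_mul_natWalsh_add_eq_window` / `MoebiusWalsh.natWalsh_add_mul_natWalsh_eq`),
this is the unshifted-window (`K = 0`) half of the type-II box estimate; the shifted windows
`K ≥ μ - ρ` ((2.23)–(2.27)) go through the localised substitute `MoebiusWalsh.localisedWalsh`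
(Lemma 5) and are not treated here.

## References

* J. Bourgain, J. Anal. Math. 119 (2013) 147–163, §2, (2.5), (2.11)–(2.22). [Bourgain2013MoebiusWalsh]
-/

noncomputable section

open Finset Real

namespace Literature.NumberTheory.LFunctions.MoebiusWalshTypeII

open Literature.NumberTheory.LFunctions.MoebiusWalshVaughan (natWalsh)
open Literature.NumberTheory.LFunctions.MoebiusWalsh (eChar walshCoeff eChar_add norm_eChar
  walshSupExponent walshL1Exponent natWalsh_eq_sum_range norm_walshCoeff_le_two_mul_rpow
  bourgain2013_lemma4 norm_sum_Ico_eChar_le_geomBound)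
open Literature.NumberTheory.Sieve.Vinogradov (geomBound geomBound_neg)

/-- **The Fourier expansion of a differenced Walsh product** (Bourgain 2013, (2.5)/(2.11), with the
geometric-series majorant): for `T ⊆ [0, q)`, `A = T.attachFin hT`, all `n h a b`,
`|∑_{a ≤ m < b} w_T(m(n+h)) w_T(mn)| ≤ ∑_{k,k'<2^q} |ŵ_A(k/2^q)| |ŵ_A(k'/2^q)| min(b−a, 1/(2‖(k(n+h)+k'n)/2^q‖))`.
[cite: Bourgain2013MoebiusWalsh, §2 (2.11)] -/
theorem abs_sum_Ico_natWalsh_mul_natWalsh_le (T : Finset ℕ) {q : ℕ} (hT : ∀ t ∈ T, t < q)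
    (n h a b : ℕ) :
    |∑ m ∈ Ico a b, natWalsh T (m * (n + h)) * natWalsh T (m * n)| ≤
      ∑ k ∈ range (2 ^ q), ∑ k' ∈ range (2 ^ q),
        ‖walshCoeff (T.attachFin hT) ((k : ℝ) / 2 ^ q)‖ *
          ‖walshCoeff (T.attachFin hT) ((k' : ℝ) / 2 ^ q)‖ *
            geomBound ((b - a : ℕ) : ℝ) (((k : ℝ) * (n + h) + k' * n) / 2 ^ q) := by
  set A := T.attachFin hT with hA
  set c : ℕ → ℂ := fun k => walshCoeff A ((k : ℝ) / 2 ^ q) with hc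
  set S := ∑ m ∈ Ico a b, natWalsh T (m * (n + h)) * natWalsh T (m * n) with hS
  set θ : ℕ → ℕ → ℝ := fun k k' => -(((k : ℝ) * (n + h) + k' * n) / 2 ^ q) with hθ
  have hSC : (S : ℂ) = ∑ k ∈ range (2 ^ q), ∑ k' ∈ range (2 ^ q),
      c k * c k' * ∑ m ∈ Ico a b, eChar (θ k k' * m) := by
    rw [hS]
    push_cast
    have hterm : ∀ m : ℕ, (natWalsh T (m * (n + h)) : ℂ) * (natWalsh T (m * n) : ℂ) =
        ∑ k ∈ range (2 ^ q), ∑ k' ∈ range (2 ^ q), c k * c k' * eChar (θ k k' * m) := by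
      intro m
      rw [natWalsh_eq_sum_range T hT, natWalsh_eq_sum_range T hT, Finset.sum_mul_sum]
      refine Finset.sum_congr rfl fun k _ => Finset.sum_congr rfl fun k' _ => ?_
      simp only [hc, hθ]
      rw [mul_mul_mul_comm, ← eChar_add]
      congr 2; push_cast; ring
    rw [Finset.sum_congr rfl fun m _ => hterm m, Finset.sum_comm]
    refine Finset.sum_congr rfl fun k _ => ?_
    rw [Finset.sum_comm]
    refine Finset.sum_congr rfl fun k' _ => ?_
    rw [Finset.mul_sum]
  have hnorm : |S| = ‖(S : ℂ)‖ := by rw [Complex.norm_real, Real.norm_eq_abs]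
  rw [hnorm, hSC]
  refine (norm_sum_le _ _).trans (Finset.sum_le_sum fun k _ => ?_)
  refine (norm_sum_le _ _).trans (Finset.sum_le_sum fun k' _ => ?_)
  rw [norm_mul, norm_mul]
  refine mul_le_mul_of_nonneg_left ?_ (by positivity)
  have hab : Ico a b = Ico a (a + (b - a)) := by
    rcases le_or_gt a b with h1 | h1
    · rw [Nat.add_sub_cancel' h1]
    · rw [Finset.Ico_eq_empty_of_le h1.le, Nat.sub_eq_zero_of_le h1.le, add_zero, Finset.Ico_self]
  rw [hab]
  refine (norm_sum_Ico_eChar_le_geomBound (θ k k') a (b - a)).trans (le_of_eq ?_)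
  simp only [hθ]
  exact geomBound_neg _ _

/-- **Type-II core count for a Walsh character, `K = 0`** — `typeII_core_zero` with the Fourier
data of `w_A` (`A ⊆ Fin q`): sup bound `η = 2·2^{-c₂|A|}` (Lemma 2) and progression bounds
`P(m) = 2·2^{κ(q-m)}` (Lemma 4). For `M ≥ 0`, `N₁ ≤ N₂` (`N = N₂ - N₁`), `H`:
`∑_{1≤h<H} ∑_{k,k'} |ŵ_A(k)||ŵ_A(k')| ∑_{n} min(M, 1/(2‖(k(n+h)+k'n)/2^q‖))`
`≤ H N η² (2HM + 2^q(1 + log 2^q)) + ∑_h ∑_{r<q} (N + 2^{q-r}) [(1 + log 2^q) P(0)P(r)`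
`+ 2 min(η² 2^{q-e} 2^{q-r}, P(e)P(r)) (2M/2^{q-r} + 2^e (1 + log 2^e))]`, `e = r - v₂(h)`.
[cite: Bourgain2013MoebiusWalsh, §2 (2.11)–(2.22)] -/
theorem typeII_core_zero_walsh {q : ℕ} (A : Finset (Fin q)) {M : ℝ} (hM : 0 ≤ M) {N₁ N₂ : ℕ}
    (hN : N₁ ≤ N₂) (H : ℕ) :
    ∑ h ∈ Ico 1 H, ∑ k ∈ range (2 ^ q), ∑ k' ∈ range (2 ^ q),
        ‖walshCoeff A ((k : ℝ) / 2 ^ q)‖ * ‖walshCoeff A ((k' : ℝ) / 2 ^ q)‖ *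
          ∑ n ∈ Ico N₁ N₂, geomBound M (((k : ℝ) * (n + h) + k' * n) / 2 ^ q) ≤
      H * (((N₂ : ℝ) - N₁) * (2 * (2 : ℝ) ^ (-(walshSupExponent * A.card))) ^ 2 *
        (2 * H * M + 2 ^ q * (1 + Real.log (2 ^ q)))) +
      ∑ h ∈ Ico 1 H, ∑ r ∈ range q, (((N₂ : ℝ) - N₁) + 2 ^ (q - r)) *
        ((1 + Real.log (2 ^ q)) *
            ((2 * (2 : ℝ) ^ (walshL1Exponent * ((q - 0 : ℕ) : ℝ))) *
              (2 * (2 : ℝ) ^ (walshL1Exponent * ((q - r : ℕ) : ℝ)))) +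
          2 * (min ((2 * (2 : ℝ) ^ (-(walshSupExponent * A.card))) ^ 2 *
                    2 ^ (q - (r - h.factorization 2)) * 2 ^ (q - r))
                  ((2 * (2 : ℝ) ^ (walshL1Exponent * ((q - (r - h.factorization 2) : ℕ) : ℝ))) *
                    (2 * (2 : ℝ) ^ (walshL1Exponent * ((q - r : ℕ) : ℝ)))) *
            (2 * (M / 2 ^ (q - r)) + 2 ^ (r - h.factorization 2) *
              (1 + Real.log (2 ^ (r - h.factorization 2)))))) := by
  set c : ℕ → ℝ := fun k => ‖walshCoeff A ((k : ℝ) / 2 ^ q)‖ with hc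
  set P : ℕ → ℝ := fun m => 2 * (2 : ℝ) ^ (walshL1Exponent * ((q - m : ℕ) : ℝ)) with hP
  have hc0 : ∀ k, 0 ≤ c k := fun k => norm_nonneg _
  have hη : ∀ k, c k ≤ 2 * (2 : ℝ) ^ (-(walshSupExponent * A.card)) := fun k =>
    norm_walshCoeff_le_two_mul_rpow A _
  have hPr : ∀ m, m ≤ q → ∀ b,
      ∑ k ∈ (range (2 ^ q)).filter (fun k => k % 2 ^ m = b % 2 ^ m), c k ≤ P m := by
    intro m hm b
    exact bourgain2013_lemma4 A hm (Nat.mod_lt _ (Nat.two_pow_pos m))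
  exact typeII_core_zero q c hc0 hη P hPr hM hN H

end Literature.NumberTheory.LFunctions.MoebiusWalshTypeII
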